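import Literature.MathematicalPhysics.QuantumFieldTheory.Balaban1983to89.B11Ineq189LeafCk
import Literature.MathematicalPhysics.QuantumFieldTheory.Balaban1983to89.B9Ineq3137LocalSup

/-!
# `Balaban1983to89.B11Ineq189LeafCkLocal` — T. Bałaban, *The variational problem and background fields in renormalization group method
# for lattice gauge theories*, Commun. Math. Phys. **102** (1985) 277–309 [Balaban1985Variational], p. 308, the author-omitted second
# differentiation behind (189): the local analytic leaf for Bałaban's `C_k(U′U₀, ·)(c)` IN LOCAL NORMS — `‖∂_u∂_v C_k(·)(c)(X)‖ ≤
# 9C₂·|u|_{B(c)}·|v|_{B(c)}` with the smallness asked of the centre ONLY ON THE BOX `B(c) = Bᵏ(c₋) ∪ Bᵏ(c₊)` — the census's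
# «LEAF BOUND |Φ_c[u, v]| ≤ 9C₂|u|_∞|v|_∞ with u, v restricted to B(c) — LOCAL, no ε» in its own currency

statement-level skeleton of published theorems with citation tags; proofs where landed; nothing here is a claim about the Yang–Mills mass gap

PDF held: `paper:balaban1985-cmp102-variational-background` (journal page = PDF page + 276), p. 308 [PDF 32]; `paper:balaban1985-cmp98-averaging`
(journal page = PDF page + 16), p. 24 (after (43)) «this definition is local in the sense that Ū^k_c, c ⊂ Ω^{(k)}, depends only on the bond
variables U_b for b ⊂ B^k(c₋) ∪ B^k(c₊)», p. 34, p. 38 (134)–(135), p. 43 Prop. 7.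

CITATION HEADER (lean-in-tree rule 2026-08-18).  WHAT IS REPRODUCED: SKELETON row **B11.Eq189** (GAPS G-B11-G2; cell census
`SECOND-DERIVATIVE-189.md` §4 U1: *«Φ_c[u, v] := (Lʲη)²∂_s∂_tC_j(X + su + tv, c)|_{s=t=0}, B(c) := Bʲ(c₋) ∪ Bʲ(c₊) … LEAF BOUND (U2 below):
|Φ_c[u, v]| ≤ 9C₂(Lʲη)²|u|_∞|v|_∞ ≤ 9C₂|u|_{(−1)}|v|_{(−1)} with u, v restricted to B(c) — LOCAL, no ε»*), composing the sibling
`B11Ineq189LeafCk.norm_d2_Ck_ins` (the 9C₂ bound in the GLOBAL sup norm of the insertion space, this seat) with the LOCALITY of the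
composite averaging at a general background (r20's `B7LocalityGeneral.logCovIter_congr`, pv-lineage `B9Ineq3137LocalSup.CCovIter_congr` /
`boxProj` / `agreeOn_insCfg_boxProj`: `C_k(U₀, ins_S a)(c) = C_k(U₀, ins_S(P_c a))(c)`, `P_c` the coordinate projection onto the bonds of the
box of `c`).

WHAT IS CERTIFIED (kernel, sorry-free; standard axioms; theorems only), under the DATA of `B11Ineq189LeafCk` (= `B7Prop7Ck`'s), for the
functional `C(a) := C_k(U′U₀, ins_S a)(c)` on `𝔸^S` and the box projection `P := boxProj S L k z κ`:
* `Ck_ins_eq_boxProj` — LOCALITY: `C(a) = C(P a)` for every `a` (no smallness);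
* `fderiv_comp_proj_apply`, `fderiv_fderiv_comp_proj_apply` [folklore, private] — for a map factoring through a continuous linear
  idempotent-like `P` (`f = f ∘ P`), differentiable near `P X`: `∂_v f(Y) = ∂_{Pv} f(PY)` and `∂_u∂_v f(X) = ∂_{Pu}∂_{Pv} f(PX)`;
* **`norm_d2_Ck_ins_local`** — `‖P X‖ < ρ/3 ⟹ ‖∂_u∂_v C(X)‖ ≤ 9C₂‖P u‖‖P v‖` (`C₂ = 8C₁′e^{E}L^{2k}`): the leaf bound with BOTH the
  directions AND the smallness of the centre measured on the box only — the currency in which the SHAPE-L/SHAPE-B terms of the census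
  (and `B11Ineq189.hasMaj₂_local`'s `hloc`) consume it;
* `norm_d1_Ck_ins_local` — `2‖P X‖ < ρ ⟹ ‖∂_v C(X)‖ ≤ 4C₂‖P X‖‖P v‖`.

HONEST SCOPE.  The identification of `‖P_c ·‖` with the printed local size `|·|_∞` on `B(c)` is `B9Ineq3137LocalSup`'s reading (ii) (the box =
both blocks and the bonds between them); the block-norm packaging over a `B6.Geometry` (`hasMaj₂_local`'s three `BlockNorm`s with a partition
of unity) is left to the assembly seat (n21-b).  (189) stays the located leaf (G-B11-G2).  Seat pub-ymgap-dag-n07-b (HUMAN RULING D-0062,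
node N07 [B11]).  Imports `B11Ineq189LeafCk` (p410143), `B9Ineq3137LocalSup`; modifies nothing; no definition, no new named fact.
-/

noncomputable section

open scoped BigOperators Topology
open NormedSpace Metric Set Finset Filter

namespace Literature.MathematicalPhysics.QuantumFieldTheory.Balaban1983to89.B11Ineq189LeafCkLocal

open Literature.MathematicalPhysics.QuantumFieldTheory.Balaban1983to89
open B7Prop1Explicit B7Prop1Local B7Prop2Explicit B7Prop3Flat MatrixLog B7Eq92Concrete B7Prop3GeneralAnalytic B7Prop3GeneralLinear
  B7Prop4GeneralLevels B7Prop5GeneralInduction B7Prop7OneStep B7Prop7Levels B7Prop7Ins B7Prop7Ck B11Ineq189LocalLeaf B11Ineq189LeafCk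
  B9Ineq3137LocalSup

/-! ## §1 Derivatives of a map that factors through a continuous linear map -/

section Factor

variable {E F : Type*} [NormedAddCommGroup E] [NormedSpace ℂ E] [NormedAddCommGroup F] [NormedSpace ℂ F] [CompleteSpace F]

omit [CompleteSpace F] in
/-- If `f = f ∘ P` and `f` is differentiable at `P Y`, then `∂_v f(Y) = ∂_{Pv} f(PY)`. [folklore] -/
private theorem fderiv_comp_proj_apply {f : E → F} (P : E →L[ℂ] E) (hfP : ∀ a, f a = f (P a)) {Y : E}
    (hd : DifferentiableAt ℂ f (P Y)) (v : E) : fderiv ℂ f Y v = fderiv ℂ f (P Y) (P v) := by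
  have h0 : HasFDerivAt (f ∘ P) ((fderiv ℂ f (P Y)).comp P) Y := hd.hasFDerivAt.comp Y P.hasFDerivAt
  have h : HasFDerivAt f ((fderiv ℂ f (P Y)).comp P) Y :=
    h0.congr_of_eventuallyEq (Filter.Eventually.of_forall fun a => hfP a)
  rw [h.fderiv]; rfl

/-- If `f = f ∘ P` and `f` is differentiable on an open set containing `P X`, then `∂_u∂_v f(X) = ∂_{Pu}∂_{Pv} f(PX)`. [folklore] -/
private theorem fderiv_fderiv_comp_proj_apply {f : E → F} (P : E →L[ℂ] E) (hfP : ∀ a, f a = f (P a)) {U : Set E}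
    (hU : IsOpen U) (hf : DifferentiableOn ℂ f U) {X : E} (hX : P X ∈ U) (u v : E) :
    fderiv ℂ (fun Y => fderiv ℂ f Y v) X u = fderiv ℂ (fun Z => fderiv ℂ f Z (P v)) (P X) (P u) := by
  -- near X the inner function is (Z ↦ ∂_{Pv} f(Z)) ∘ P
  have hnear : (fun Y => fderiv ℂ f Y v) =ᶠ[𝓝 X] (fun Z => fderiv ℂ f Z (P v)) ∘ P := by
    have hopen : IsOpen (P ⁻¹' U) := hU.preimage P.continuous
    filter_upwards [hopen.mem_nhds (show X ∈ P ⁻¹' U from hX)] with Y hY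
    exact fderiv_comp_proj_apply P hfP (hf.differentiableAt (hU.mem_nhds hY)) v
  rw [hnear.fderiv_eq]
  have hg : DifferentiableAt ℂ (fun Z => fderiv ℂ f Z (P v)) (P X) :=
    (Literature.Analysis.Complex.SCV.differentiableOn_fderiv_apply hf hU (P v)).differentiableAt (hU.mem_nhds hX)
  have h : HasFDerivAt ((fun Z => fderiv ℂ f Z (P v)) ∘ P) ((fderiv ℂ (fun Z => fderiv ℂ f Z (P v)) (P X)).comp P) X :=
    hg.hasFDerivAt.comp X P.hasFDerivAt
  rw [h.fderiv]; rfl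

end Factor

/-! ## §2 Locality of `C_k(U′U₀, ins_S ·)(c)` and the leaf in local norms -/

variable {d : ℕ}

variable {𝔸 : Type*} [NormedRing 𝔸] [NormedAlgebra ℂ 𝔸] [CompleteSpace 𝔸] [NormOneClass 𝔸]

variable (L : ℕ) (hL : 2 ≤ L) {G : Subgroup 𝔸ˣ} (hG : AvgClosed d L G) (k : ℕ)
  (U₀ : B7Prop1Explicit.Site d → Fin d → 𝔸ˣ) (hU₀ : ∀ x κ, U₀ x κ ∈ G) {α₀ : ℝ} (hα : 0 < α₀)
  (hα3 : C0 d * α₀ ≤ 1 / 3) (hα8 : 8 * α₀ ≤ c2' d L) (h52 : pdev U₀ < α₀ * (((L : ℝ) ^ k)⁻¹) ^ 2)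
  (B' : B7Prop1Explicit.Site d → Fin d → 𝔸) {b' : ℝ} (hb' : 0 ≤ b') (hB' : ∀ x κ, ‖B' x κ‖ ≤ b')
  (hsmall' : Real.exp (4 * (800 * ((d : ℝ) + 1) ^ 2 * ((d : ℝ) + 4)) * α₀)
    * (1 + 8 * (131072 * ((d : ℝ) + 1) ^ 2) * ((L : ℝ) ^ k * b')) ≤ 2)
  (hc₃' : 2 * ((L : ℝ) ^ k * b') ≤ c3 d L) (hb'1 : 409600 * ((d : ℝ) + 1) ^ 2 * ((L : ℝ) ^ k * b') ≤ 1)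
  {ρ : ℝ} (hρ : 0 < ρ)
  (hρsmall : Real.exp (4480 * ((d : ℝ) + 1) ^ 2 * ((d : ℝ) + 4) * α₀ + 240000 * ((d : ℝ) + 1) ^ 3 * ((L : ℝ) ^ k * b'))
    * (1 + 8 * (2097152 * ((d : ℝ) + 1) ^ 2) * ((L : ℝ) ^ k * ρ)) ≤ 2)
  (hρc₃ : 2 * ((L : ℝ) ^ k * ρ) ≤ c3 d L / 4)

include hL in
omit [NormOneClass 𝔸] in
/-- **LOCALITY of `C_k(U′U₀, ins_S ·)(c)`** ([4] p. 24: *«depends only on the bond variables U_b for b ⊂ B^k(c₋) ∪ B^k(c₊)»*): the value at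
the `Lᵏ`-bond `c = (z, κ)` is unchanged when the inserted field is replaced by its box projection `P_c a` (`B9Ineq3137LocalSup.CCovIter_congr`
with `agreeOn_insCfg_boxProj`). [cite: Balaban1985Averaging, p.24 (after (43)), p.34, (127) p.37] -/
theorem Ck_ins_eq_boxProj (S : Finset (B7Prop1Explicit.Site d × Fin d)) (z : B7Prop1Explicit.Site d) (κ : Fin d) (a : S → 𝔸) :
    logCovIter L (expCfg B' * U₀) (insCfg S a) k z κ - linCovIter L (expCfg B' * U₀) (insCfg S a) k z κ =
      logCovIter L (expCfg B' * U₀) (insCfg S (boxProj S L k z κ a)) k z κ -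
        linCovIter L (expCfg B' * U₀) (insCfg S (boxProj S L k z κ a)) k z κ := by
  have hL1 : 1 ≤ L := le_trans (by norm_num) hL
  have h := CCovIter_congr L hL1 k (U₀ := expCfg B' * U₀) (U₀' := expCfg B' * U₀) z κ (fun _ _ _ _ => rfl)
    (agreeOn_insCfg_boxProj S L k z κ a)
  simpa [CCovIter] using h

include hL hG hU₀ hα hα3 hα8 h52 hb' hB' hsmall' hc₃' hb'1 hρ hρsmall hρc₃ in
/-- **THE LEAF IN LOCAL NORMS** (census U1/U2: *«|Φ_c[u, v]| ≤ 9C₂|u|_∞|v|_∞ with u, v restricted to B(c) — LOCAL, no ε»*): if the centre is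
small ON THE BOX, `‖P_c X‖ < ρ/3`, then for all directions `‖∂_u∂_v C_k(U′U₀, ins_S ·)(c)(X)‖ ≤ 9·C₂·‖P_c u‖·‖P_c v‖`, `C₂ = 8C₁′e^{E}L^{2k}` —
locality (`Ck_ins_eq_boxProj`) + §1 + `B11Ineq189LeafCk.norm_d2_Ck_ins` at the centre `P_c X` in the directions `P_c u`, `P_c v`.
[cite: Balaban1985Variational, (189) p.308] [cite: Balaban1985Averaging, Prop. 4 (134)–(135) p.38, Prop. 7 p.43, p.24] -/
theorem norm_d2_Ck_ins_local (S : Finset (B7Prop1Explicit.Site d × Fin d)) (z : B7Prop1Explicit.Site d) (κ : Fin d) {X : S → 𝔸}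
    (hX : ‖boxProj S L k z κ X‖ < ρ / 3) (u v : S → 𝔸) :
    ‖fderiv ℂ (fun Y : S → 𝔸 => fderiv ℂ (fun a : S → 𝔸 =>
        logCovIter L (expCfg B' * U₀) (insCfg S a) k z κ - linCovIter L (expCfg B' * U₀) (insCfg S a) k z κ) Y v) X u‖ ≤
      9 * (8 * (2097152 * ((d : ℝ) + 1) ^ 2)
        * Real.exp (4480 * ((d : ℝ) + 1) ^ 2 * ((d : ℝ) + 4) * α₀ + 240000 * ((d : ℝ) + 1) ^ 3 * ((L : ℝ) ^ k * b'))
        * ((L : ℝ) ^ k) ^ 2) * ‖boxProj S L k z κ u‖ * ‖boxProj S L k z κ v‖ := by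
  set P := boxProj S L k z κ (𝔸 := 𝔸) with hP
  have hPX : P X ∈ ball (0 : S → 𝔸) ρ := by
    rw [mem_ball_zero_iff]; linarith [norm_nonneg (P X)]
  have hfact := fderiv_fderiv_comp_proj_apply P
    (Ck_ins_eq_boxProj L hL k U₀ B' S z κ) isOpen_ball
    (differentiableOn_Ck_ins L hL hG k U₀ hU₀ hα hα3 hα8 h52 B' hb' hB' hsmall' hc₃' hb'1 hρ hρsmall hρc₃ S z κ) hPX u v
  rw [hfact]
  exact norm_d2_Ck_ins L hL hG k U₀ hU₀ hα hα3 hα8 h52 B' hb' hB' hsmall' hc₃' hb'1 hρ hρsmall hρc₃ S z κ hX (P u) (P v)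

include hL hG hU₀ hα hα3 hα8 h52 hb' hB' hsmall' hc₃' hb'1 hρ hρsmall hρc₃ in
/-- **The first derivative in local norms**: `2‖P_c X‖ < ρ ⟹ ‖∂_v C_k(U′U₀, ins_S ·)(c)(X)‖ ≤ 4C₂‖P_c X‖‖P_c v‖` (p. 291's mechanism, box
currency). [cite: Balaban1985Variational, p.291 + (185)–(186) p.308] [cite: Balaban1985Averaging, Prop. 4 (134)–(135) p.38, p.24] -/
theorem norm_d1_Ck_ins_local (S : Finset (B7Prop1Explicit.Site d × Fin d)) (z : B7Prop1Explicit.Site d) (κ : Fin d) {X : S → 𝔸}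
    (hX : 2 * ‖boxProj S L k z κ X‖ < ρ) (v : S → 𝔸) :
    ‖fderiv ℂ (fun a : S → 𝔸 =>
        logCovIter L (expCfg B' * U₀) (insCfg S a) k z κ - linCovIter L (expCfg B' * U₀) (insCfg S a) k z κ) X v‖ ≤
      4 * (8 * (2097152 * ((d : ℝ) + 1) ^ 2)
        * Real.exp (4480 * ((d : ℝ) + 1) ^ 2 * ((d : ℝ) + 4) * α₀ + 240000 * ((d : ℝ) + 1) ^ 3 * ((L : ℝ) ^ k * b'))
        * ((L : ℝ) ^ k) ^ 2) * ‖boxProj S L k z κ X‖ * ‖boxProj S L k z κ v‖ := by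
  set P := boxProj S L k z κ (𝔸 := 𝔸) with hP
  have hPX : P X ∈ ball (0 : S → 𝔸) ρ := by
    rw [mem_ball_zero_iff]; linarith [norm_nonneg (P X)]
  have hd := (differentiableOn_Ck_ins L hL hG k U₀ hU₀ hα hα3 hα8 h52 B' hb' hB' hsmall' hc₃' hb'1 hρ hρsmall hρc₃ S z κ).differentiableAt
    (isOpen_ball.mem_nhds hPX)
  rw [fderiv_comp_proj_apply P (Ck_ins_eq_boxProj L hL k U₀ B' S z κ) hd v]
  exact norm_d1_Ck_ins L hL hG k U₀ hU₀ hα hα3 hα8 h52 B' hb' hB' hsmall' hc₃' hb'1 hρ hρsmall hρc₃ S z κ hX (P v)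

end Literature.MathematicalPhysics.QuantumFieldTheory.Balaban1983to89.B11Ineq189LeafCkLocal

end
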